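import Summits.QuantumFields.BalabanUV.T4Continuum.Support.NE3DiscreteGradientEstimate
import Summits.QuantumFields.BalabanUV.T4Continuum.Spine.NE3.PairLandauB8
import Summits.QuantumFields.BalabanUV.T4Continuum.Spine.NE3.SlicePoincareSlicB8Gauge
import Summits.QuantumFields.BalabanUV.T4Continuum.Support.AveragingDeficitCovGrad
import HarnessLib

/-!
# T⁴ programme, node NE3 — census R39 (file 1): SUP-REGULARITY OF THE COVARIANT SITE LAPLACIAN AT A CURVED BACKGROUND FROM LOCAL NEAR-IDENTITY
# GAUGES WITH DIVERGENCE CONTROL — the maximum principle of R37 perturbed (curved (H0_W) ⇐ a local-gauge SHAPE + a covariant sup block-mean SHAPE)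

Cell `pub-balaban-gaps` (YM blitz, track G2, seat `ne3`, unit `pub-balaban-gaps-ne3-g8`; writer prover-pub-balaban-gaps-ne3-g8-0, 2026-08-24), census
`run/shared/lean/pub/pub-balaban-gaps/ne/NE3.md` §4 R39, §14.  WHY.  R37 proved (H0) at `W = 1` by the lattice maximum principle.  At a CURVED unitary background `W` the
END's per-pair binder (H0_W) (`PairLandauB8EndSupFacts`: `‖u‖_∞ ≤ c₀M²‖Δ_Wu‖_∞`, `‖D_Wu‖_∞ ≤ c₁M‖Δ_Wu‖_∞` on `N(Q′(W))`) is a [B9] (3.42)-TYPE.  THIS FILE reduces it to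
two displayed KINEMATIC shapes by perturbing R37: if around every bond `(y₀, μ₀)` there is a unitary site gauge `g` in which the bond variables of `W^g` on the sup-cube of radius
`R + 1` are within `a` of `1` AND the lattice divergence of `E := W^g − 1` is within `δ` on the cube of radius `R` (the LOCAL GAUGE SHAPE `hgauge`), and if `‖u‖_∞ ≤ C_U·‖D_Wu‖_∞`
(the covariant sup block-mean SHAPE `hU`, `C_U ≍ dM` for `u ∈ N(Q′(W))` by the curved (‡)), then under ONE line `2dC_U∕R + (4Rδ + 24Rda² + 2a)C_U + 8Rda ≤ ½`:
`‖D_Wu‖_∞ ≤ 4R·‖Δ_Wu‖_∞` and `‖u‖_∞ ≤ 4C_UR·‖Δ_Wu‖_∞`.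

MECHANISM (§1, exact algebra + crude bounds; §2, the bootstrap).  In the gauge `W′ = W^g`, `ũ = Ad_g u`: `Ad_V X − X = (EX − XE)V⁻¹` and `Ad_{V⁻¹}X − X = −V⁻¹(EX − XE)` (`E = V − 1`)
EXACTLY, so at a site `y` with neighbours `X± = ũ(y ± e_ν)`, `Vp = W′(y,ν)`, `Vm = W′(y − e_ν, ν)`:
`Δ_{W′}ũ(y) = −Δ^{flat}ũ(y) − Σ_ν(T₊ + T₋)`, `T₊ + T₋ = [Ep − Em, ũ(y)] + O(4a²‖ũ‖ + 2a‖Xp − ũ‖ + 2a‖Xm − ũ‖)`, and `Σ_ν[Ep − Em, ũ] = [div E, ũ]`: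
`‖Δ^{flat}ũ(y)‖ ≤ ‖Δ_Wu(y)‖ + 2δU + 4da(G + 2aU) + 4da²U` (`‖ũ(x+e) − ũ(x)‖ ≤ ‖D_{W′}ũ‖ + 2aU = G + 2aU`).  R37's `norm_sub_le_of_laplacian` on the cube then bounds
`‖ũ(y₀ + e_μ₀) − ũ(y₀)‖`, hence `‖D_Wu(y₀,μ₀)‖ ≤ 2(dU∕R + R·B_eff) + 2aU`, and the sup over bonds closes under the line.  WHERE THE SHAPES COME FROM (census R39, NOT here):
the comb gauge of `NE3CombGauge` gives `a ≍ dR·x` from `SmallField W x`; its divergence is a sum of ≤ `R` covariant FLUX GRADIENTS along the comb strips, so `δ ≍ dR·x₁ + R²x²` needs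
the flux-gradient regularity `‖∇_WF‖ ≤ x₁ ≍ x∕M` of [B11] Thm 1 (10) ∕ [B8] (1.34) TYPE (the small-field current bound (1.9) alone gives only partial currents in `d ≥ 3`); with `R ≍ M`
the line reads `M²x`, `M³x₁` small — k-free.  Neither the comb divergence bound nor `C_U` is proved in this file.

CONTENT (0 sorry; no `def`; [folklore]).  HONEST FRAMING.  A CONDITIONAL reduction: (H0_W) at a curved background ⇐ two displayed kinematic hypothesis shapes + one numeric line; the
shapes are NOT discharged here for any background; `hK`∕(P♮) at curved `W`, `PairLandauGaugeB8Avg`, the covariant root and **NE3 are NOT proved**; spine PROVED 0∕9; finite T⁴ rung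
(B)+1 — NOT infinite volume, NOT mass gap, NOT `BetaPertH`, NOT Clay.  PLACEMENT: `Summits/QuantumFields/BalabanUV/T4Continuum/Spine/NE3/`; imports accepted modules only.
-/

set_option autoImplicit false

open scoped BigOperators Matrix Matrix.Norms.L2Operator
open NormedSpace Finset

namespace Summit.QuantumFields.BalabanUV.T4Continuum.NE3.SupRegularityLocalGauge

open Literature.MathematicalPhysics.QuantumFieldTheory.Balaban1983to89
open B7Prop1Explicit B7Prop2Explicit MatrixNorms
open T4AveragingDeficitWall (Ad IsUnitaryCfg IsSkewDir)
open T4AveragingDeficitWallBoundary (IsPeriodicCfg periodBox mem_periodBox)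
open T4AveragingDeficitNonAbelian (Ad_sub Ad_mul)
open AveragingDeficitPeriodicCounting (IsPeriodicDir)
open AveragingDeficitTorusChart (periodic_smul_vec)
open AveragingDeficitNearIdentity (norm_Ad_sub_le Ad_one)
open AveragingDeficitCovGrad (norm_Ad_inv_sub_le)
open AveragingDeficitTransport (norm_Ad_of_unitary mem_U1_of_unitary)
open AveragingDeficitKDatum (isUnitaryCfg_gaugeAct)
open BlockAveragePushDirGauge (gaugeDir isPeriodicDir_gaugeDir)
open SkeletonLattice (cdiv cmod smul_cdiv_add_cmod cmod_nonneg cmod_lt)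
open NE3CovariantCalculus (cD cDstar)
open NE3CpushGaugeCovariance (gaugeDir_gaugeAct)
open NE3.PairLandauB8 (covLapSite)
open NE3.SlicePoincareSlicB8Gauge (covLapSite_gaugeAct)
open NE3DiscreteGradientEstimate (norm_sub_le_of_laplacian)

noncomputable section

variable {d : ℕ} {n : Type*} [Fintype n] [DecidableEq n]

local notation "𝕄" => Matrix n n ℂ

/-! ## §1 The covariant site Laplacian in a near-identity gauge: exact algebra and crude bounds -/

/-- `Ad_V X − X = ((V − 1)X − X(V − 1))·V⁻¹`, exactly. [folklore] -/
theorem Ad_sub_self_eq_comm (V : 𝕄ˣ) (X : 𝕄) :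
    Ad V X - X = (((V : 𝕄) - 1) * X - X * ((V : 𝕄) - 1)) * ((V⁻¹ : 𝕄ˣ) : 𝕄) := by
  have h1 : ((V : 𝕄) - 1) * X - X * ((V : 𝕄) - 1) = (V : 𝕄) * X - X * (V : 𝕄) := by noncomm_ring
  rw [h1, sub_mul, mul_assoc X, Units.mul_inv, mul_one]
  rfl

/-- `Ad_{V⁻¹} X − X = −V⁻¹·((V − 1)X − X(V − 1))`, exactly. [folklore] -/
theorem Ad_inv_sub_self_eq_comm (V : 𝕄ˣ) (X : 𝕄) :
    Ad V⁻¹ X - X = -(((V⁻¹ : 𝕄ˣ) : 𝕄) * (((V : 𝕄) - 1) * X - X * ((V : 𝕄) - 1))) := by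
  have h1 : ((V : 𝕄) - 1) * X - X * ((V : 𝕄) - 1) = (V : 𝕄) * X - X * (V : 𝕄) := by noncomm_ring
  rw [h1, mul_sub, ← mul_assoc, ← mul_assoc, Units.inv_mul, one_mul]
  unfold Ad
  rw [inv_inv, neg_sub]

/-- `‖EX − XE‖ ≤ 2‖E‖‖X‖`. [folklore] -/
theorem norm_comm_le (E X : 𝕄) : ‖E * X - X * E‖ ≤ 2 * ‖E‖ * ‖X‖ := by
  calc ‖E * X - X * E‖ ≤ ‖E * X‖ + ‖X * E‖ := norm_sub_le _ _
    _ ≤ ‖E‖ * ‖X‖ + ‖X‖ * ‖E‖ := add_le_add (opNorm_mul_le _ _) (opNorm_mul_le _ _)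
    _ = 2 * ‖E‖ * ‖X‖ := by ring

/-- **ONE DIRECTION OF THE EXPANSION**: for unitary `Vp`, `Vm` with `‖V± − 1‖ ≤ a ≤ 1`, sites values `X`, `Xp`, `Xm`:
`‖(Ad_{Vp}Xp − Xp) + (Ad_{Vm⁻¹}Xm − Xm) − ((Ep − Em)X − X(Ep − Em))‖ ≤ 4a²‖X‖ + 2a‖Xp − X‖ + 2a‖Xm − X‖` (`E± = V± − 1`). [folklore] -/
theorem norm_transport_pair_sub_comm_le [Nonempty n] {Vp Vm : 𝕄ˣ} (hVp : Vp ∈ unitaryUnits 𝕄) (hVm : Vm ∈ unitaryUnits 𝕄)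
    {a : ℝ} (hap : ‖(Vp : 𝕄) - 1‖ ≤ a) (ham : ‖(Vm : 𝕄) - 1‖ ≤ a) (X Xp Xm : 𝕄) :
    ‖(Ad Vp Xp - Xp) + (Ad Vm⁻¹ Xm - Xm)
        - ((((Vp : 𝕄) - 1) - ((Vm : 𝕄) - 1)) * X - X * (((Vp : 𝕄) - 1) - ((Vm : 𝕄) - 1)))‖
      ≤ 4 * a ^ 2 * ‖X‖ + 2 * a * ‖Xp - X‖ + 2 * a * ‖Xm - X‖ := by
  have ha0 : 0 ≤ a := (norm_nonneg _).trans hap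
  have hip : ‖((Vp⁻¹ : 𝕄ˣ) : 𝕄) - 1‖ ≤ a := (norm_inv_sub_one_le (mem_U1_of_unitary hVp)).trans hap
  have him : ‖((Vm⁻¹ : 𝕄ˣ) : 𝕄) - 1‖ ≤ a := (norm_inv_sub_one_le (mem_U1_of_unitary hVm)).trans ham
  -- split off the fluctuations `X± − X`
  have hsplitp : Ad Vp Xp - Xp = (Ad Vp X - X) + (Ad Vp (Xp - X) - (Xp - X)) := by rw [Ad_sub]; abel
  have hsplitm : Ad Vm⁻¹ Xm - Xm = (Ad Vm⁻¹ X - X) + (Ad Vm⁻¹ (Xm - X) - (Xm - X)) := by rw [Ad_sub]; abel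
  -- the values at `X`: exact commutator form
  set Ep : 𝕄 := (Vp : 𝕄) - 1 with hEp
  set Em : 𝕄 := (Vm : 𝕄) - 1 with hEm
  have hcp : Ad Vp X - X = (Ep * X - X * Ep) + (Ep * X - X * Ep) * (((Vp⁻¹ : 𝕄ˣ) : 𝕄) - 1) := by
    rw [Ad_sub_self_eq_comm, hEp]; noncomm_ring
  have hcm : Ad Vm⁻¹ X - X = -(Em * X - X * Em) - (((Vm⁻¹ : 𝕄ˣ) : 𝕄) - 1) * (Em * X - X * Em) := by
    rw [Ad_inv_sub_self_eq_comm, hEm]; noncomm_ring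
  have hkey : (Ad Vp Xp - Xp) + (Ad Vm⁻¹ Xm - Xm) - ((Ep - Em) * X - X * (Ep - Em))
      = (Ep * X - X * Ep) * (((Vp⁻¹ : 𝕄ˣ) : 𝕄) - 1) - (((Vm⁻¹ : 𝕄ˣ) : 𝕄) - 1) * (Em * X - X * Em)
        + (Ad Vp (Xp - X) - (Xp - X)) + (Ad Vm⁻¹ (Xm - X) - (Xm - X)) := by
    rw [hsplitp, hsplitm, hcp, hcm]; noncomm_ring
  rw [hkey]
  have hEpa : ‖Ep‖ ≤ a := hap
  have hEma : ‖Em‖ ≤ a := ham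
  have h1 : ‖(Ep * X - X * Ep) * (((Vp⁻¹ : 𝕄ˣ) : 𝕄) - 1)‖ ≤ 2 * a * ‖X‖ * a :=
    (opNorm_mul_le _ _).trans (mul_le_mul ((norm_comm_le _ _).trans (by gcongr)) hip (norm_nonneg _) (by positivity))
  have h2 : ‖(((Vm⁻¹ : 𝕄ˣ) : 𝕄) - 1) * (Em * X - X * Em)‖ ≤ a * (2 * a * ‖X‖) :=
    (opNorm_mul_le _ _).trans (mul_le_mul him ((norm_comm_le _ _).trans (by gcongr)) (norm_nonneg _) ha0)
  have h3 : ‖Ad Vp (Xp - X) - (Xp - X)‖ ≤ 2 * a * ‖Xp - X‖ :=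
    (norm_Ad_sub_le hVp _).trans (by gcongr)
  have h4 : ‖Ad Vm⁻¹ (Xm - X) - (Xm - X)‖ ≤ 2 * a * ‖Xm - X‖ :=
    (norm_Ad_inv_sub_le hVm _).trans (by gcongr)
  calc _ ≤ ‖(Ep * X - X * Ep) * (((Vp⁻¹ : 𝕄ˣ) : 𝕄) - 1) - (((Vm⁻¹ : 𝕄ˣ) : 𝕄) - 1) * (Em * X - X * Em)
          + (Ad Vp (Xp - X) - (Xp - X))‖ + ‖Ad Vm⁻¹ (Xm - X) - (Xm - X)‖ := norm_add_le _ _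
    _ ≤ (‖(Ep * X - X * Ep) * (((Vp⁻¹ : 𝕄ˣ) : 𝕄) - 1) - (((Vm⁻¹ : 𝕄ˣ) : 𝕄) - 1) * (Em * X - X * Em)‖
          + ‖Ad Vp (Xp - X) - (Xp - X)‖) + ‖Ad Vm⁻¹ (Xm - X) - (Xm - X)‖ := by gcongr; exact norm_add_le _ _
    _ ≤ ((2 * a * ‖X‖ * a + a * (2 * a * ‖X‖)) + 2 * a * ‖Xp - X‖) + 2 * a * ‖Xm - X‖ := by
          gcongr
          exact (norm_sub_le _ _).trans (add_le_add h1 h2)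
    _ = 4 * a ^ 2 * ‖X‖ + 2 * a * ‖Xp - X‖ + 2 * a * ‖Xm - X‖ := by ring

/-- **THE COVARIANT SITE LAPLACIAN IS THE FLAT ONE UP TO THE TRANSPORT PAIRS**:
`covLapSite V v y = −Σ_ν ((v(y+e_ν) − v y) − (v y − v(y−e_ν))) − Σ_ν ((Ad_{V(y,ν)}v(y+e_ν) − v(y+e_ν)) + (Ad_{V(y−e_ν,ν)⁻¹}v(y−e_ν) − v(y−e_ν)))`. [folklore] -/
theorem covLapSite_eq_neg_flat_sub_transport (V : Site d → Fin d → 𝕄ˣ) (v : Site d → 𝕄) (y : Site d) :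
    covLapSite V v y = -(∑ ν : Fin d, ((v (y + e ν) - v y) - (v y - v (y - e ν))))
      - ∑ ν : Fin d, ((Ad (V y ν) (v (y + e ν)) - v (y + e ν)) + (Ad (V (y - e ν) ν)⁻¹ (v (y - e ν)) - v (y - e ν))) := by
  unfold covLapSite cDstar cD
  rw [← Finset.sum_neg_distrib, ← Finset.sum_sub_distrib]
  refine Finset.sum_congr rfl fun ν _ => ?_
  simp only [sub_add_cancel]
  rw [Ad_sub, ← Ad_mul, inv_mul_cancel, Ad_one]
  abel

/-- **THE FLAT LATTICE LAPLACIAN IN A NEAR-IDENTITY GAUGE** (`d` directions, unitary `V`): if at the site `y` every bond variable `V(y,ν)`, `V(y−e_ν,ν)` is within `a ≤ 1` of `1`,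
the lattice divergence of `E = V − 1` at `y` has norm `≤ δ`, `‖v y‖ ≤ U`, and the flat forward differences at the bonds `(y,ν)`, `(y−e_ν,ν)` have norm `≤ G'`, then
`‖Σ_ν ((v(y+e_ν) − v y) − (v y − v(y−e_ν)))‖ ≤ ‖covLapSite V v y‖ + 2δU + 4d·a·G' + 4d·a²·U`. [folklore] -/
theorem norm_flatLaplacian_le [Nonempty n] {V : Site d → Fin d → 𝕄ˣ} (hV : IsUnitaryCfg V) (v : Site d → 𝕄) (y : Site d)
    {a δ U G' : ℝ} (ha0 : 0 ≤ a)
    (haV : ∀ ν : Fin d, ‖((V y ν : 𝕄ˣ) : 𝕄) - 1‖ ≤ a ∧ ‖((V (y - e ν) ν : 𝕄ˣ) : 𝕄) - 1‖ ≤ a)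
    (hdiv : ‖∑ ν : Fin d, ((((V y ν : 𝕄ˣ) : 𝕄) - 1) - (((V (y - e ν) ν : 𝕄ˣ) : 𝕄) - 1))‖ ≤ δ)
    (hU : ‖v y‖ ≤ U) (hG : ∀ ν : Fin d, ‖v (y + e ν) - v y‖ ≤ G' ∧ ‖v (y - e ν) - v y‖ ≤ G') :
    ‖∑ ν : Fin d, ((v (y + e ν) - v y) - (v y - v (y - e ν)))‖
      ≤ ‖covLapSite V v y‖ + 2 * δ * U + 4 * (d : ℝ) * a * G' + 4 * (d : ℝ) * a ^ 2 * U := by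
  have hU0 : 0 ≤ U := (norm_nonneg _).trans hU
  set D : Fin d → 𝕄 := fun ν => (((V y ν : 𝕄ˣ) : 𝕄) - 1) - (((V (y - e ν) ν : 𝕄ˣ) : 𝕄) - 1) with hD_def
  set T : Fin d → 𝕄 := fun ν => (Ad (V y ν) (v (y + e ν)) - v (y + e ν)) + (Ad (V (y - e ν) ν)⁻¹ (v (y - e ν)) - v (y - e ν))
    with hT_def
  -- the flat Laplacian is `−(covLapSite + Σ T)`
  have hflat : ∑ ν : Fin d, ((v (y + e ν) - v y) - (v y - v (y - e ν))) = -(covLapSite V v y + ∑ ν : Fin d, T ν) := by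
    rw [covLapSite_eq_neg_flat_sub_transport V v y]
    simp only [hT_def]
    abel
  -- each transport pair is the commutator with `D ν` up to `4a²U + 4aG'`
  have hT : ∀ ν : Fin d, ‖T ν - (D ν * v y - v y * D ν)‖ ≤ 4 * a ^ 2 * U + 4 * a * G' := by
    intro ν
    have h := norm_transport_pair_sub_comm_le (hV y ν) (hV (y - e ν) ν) (haV ν).1 (haV ν).2 (v y) (v (y + e ν)) (v (y - e ν))
    have h1 : 4 * a ^ 2 * ‖v y‖ + 2 * a * ‖v (y + e ν) - v y‖ + 2 * a * ‖v (y - e ν) - v y‖ ≤ 4 * a ^ 2 * U + 4 * a * G' := by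
      have e1 := (hG ν).1
      have e2 := (hG ν).2
      nlinarith [mul_nonneg ha0 (norm_nonneg (v (y + e ν) - v y)), sq_nonneg a, norm_nonneg (v y)]
    exact h.trans h1
  -- the commutators sum to the commutator with the divergence
  have hsumD : ∑ ν : Fin d, (D ν * v y - v y * D ν) = (∑ ν : Fin d, D ν) * v y - v y * ∑ ν : Fin d, D ν := by
    rw [Finset.sum_sub_distrib, Finset.sum_mul, Finset.mul_sum]
  have hcomm : ‖∑ ν : Fin d, (D ν * v y - v y * D ν)‖ ≤ 2 * δ * U := by
    rw [hsumD]
    refine (norm_comm_le _ _).trans ?_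
    have hδ0 : 0 ≤ δ := (norm_nonneg _).trans hdiv
    calc 2 * ‖∑ ν : Fin d, D ν‖ * ‖v y‖ ≤ 2 * δ * U := by gcongr
      _ = 2 * δ * U := rfl
  -- assemble
  have hsumT : ‖∑ ν : Fin d, T ν‖ ≤ 2 * δ * U + 4 * (d : ℝ) * a * G' + 4 * (d : ℝ) * a ^ 2 * U := by
    have hsplit : ∑ ν : Fin d, T ν = ∑ ν : Fin d, (D ν * v y - v y * D ν) + ∑ ν : Fin d, (T ν - (D ν * v y - v y * D ν)) := by
      rw [← Finset.sum_add_distrib]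
      exact Finset.sum_congr rfl fun ν _ => by abel
    rw [hsplit]
    refine (norm_add_le _ _).trans ?_
    have h2 : ‖∑ ν : Fin d, (T ν - (D ν * v y - v y * D ν))‖ ≤ ∑ _ν : Fin d, (4 * a ^ 2 * U + 4 * a * G') :=
      (norm_sum_le _ _).trans (Finset.sum_le_sum fun ν _ => hT ν)
    rw [Finset.sum_const, Finset.card_univ, Fintype.card_fin, nsmul_eq_mul] at h2
    linarith [hcomm, h2]
  rw [hflat, norm_neg]
  exact (norm_add_le _ _).trans (by linarith [hsumT])

/-- Flat forward differences in a near-identity gauge: `‖v(x+e_ν) − v x‖ ≤ ‖D_V v (x,ν)‖ + 2‖V(x,ν) − 1‖·‖v x‖` and the reverse triangle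
`‖D_V v (x,ν)‖ ≤ ‖v(x+e_ν) − v x‖ + 2‖V(x,ν) − 1‖·‖v x‖`. [folklore] -/
theorem norm_fdiff_le_gaugeDir_add [Nonempty n] {V : Site d → Fin d → 𝕄ˣ} (hV : IsUnitaryCfg V) (v : Site d → 𝕄) (x : Site d) (ν : Fin d) :
    ‖v (x + e ν) - v x‖ ≤ ‖gaugeDir V v x ν‖ + 2 * ‖((V x ν : 𝕄ˣ) : 𝕄) - 1‖ * ‖v x‖ ∧
      ‖gaugeDir V v x ν‖ ≤ ‖v (x + e ν) - v x‖ + 2 * ‖((V x ν : 𝕄ˣ) : 𝕄) - 1‖ * ‖v x‖ := by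
  have h1 : v (x + e ν) - v x = (Ad (V x ν)⁻¹ (v x) - v x) - gaugeDir V v x ν := by simp only [gaugeDir]; abel
  have h2 : gaugeDir V v x ν = (Ad (V x ν)⁻¹ (v x) - v x) - (v (x + e ν) - v x) := by rw [h1]; abel
  have h3 := norm_Ad_inv_sub_le (hV x ν) (v x)
  constructor
  · rw [h1]; exact (norm_sub_le _ _).trans (by linarith)
  · rw [h2]; exact (norm_sub_le _ _).trans (by linarith)

/-! ## §2 The perturbed bootstrap: curved (H0_W) from the local-gauge shape and the covariant sup block-mean shape -/

/-- **SUP-REGULARITY OF THE COVARIANT SITE LAPLACIAN FROM LOCAL NEAR-IDENTITY GAUGES WITH DIVERGENCE CONTROL** (census R39, file 1): let `d ≥ 1`, `W` unitary and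
`P`-periodic, `u` `P`-periodic with `‖Δ_Wu‖_∞ ≤ B`; assume (hU) the covariant sup block-mean SHAPE `‖u‖_∞ ≤ C_U·‖D_Wu‖_∞`, and (hgauge) the LOCAL GAUGE SHAPE: around
every bond `(y₀, μ₀)` a unitary site gauge `g` with `‖W^g(x,ν) − 1‖ ≤ a` on the sup-cube of radius `R + 1` and `‖Σ_ν(E(x,ν) − E(x−e_ν,ν))‖ ≤ δ` (`E = W^g − 1`) on the
sup-cube of radius `R`.  Then under the line `2dC_U∕R + (4Rδ + 24Rda² + 2a)C_U + 8Rda ≤ ½`: `‖D_Wu‖_∞ ≤ 4R·B` and `‖u‖_∞ ≤ 4C_UR·B`.  Proof: §1 in the gauge at the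
maximising bond + R37's `norm_sub_le_of_laplacian`. [folklore] -/
theorem supRegularity_of_localGauge [Nonempty n] (hd : 1 ≤ d) {P : ℕ} (hP : 1 ≤ P)
    {W : Site d → Fin d → 𝕄ˣ} (hWu : IsUnitaryCfg W) (hWP : IsPeriodicCfg W (P : ℤ))
    {u : Site d → 𝕄} (huP : ∀ (x : Site d) (i : Fin d), u (x + (P : ℤ) • e i) = u x)
    {R : ℕ} (hR : 1 ≤ R) {a δ CU B : ℝ} (ha0 : 0 ≤ a) (hCU : 0 ≤ CU)
    (hB : ∀ y : Site d, ‖covLapSite W u y‖ ≤ B)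
    (hU : ∀ s : ℝ, (∀ (x : Site d) (μ : Fin d), ‖gaugeDir W u x μ‖ ≤ s) → ∀ y : Site d, ‖u y‖ ≤ CU * s)
    (hgauge : ∀ (y₀ : Site d) (μ₀ : Fin d), ∃ g : Site d → 𝕄ˣ, (∀ x, g x ∈ unitaryUnits 𝕄) ∧
      (∀ (x : Site d) (ν : Fin d), (∀ i, |x i - y₀ i| ≤ (R : ℤ) + 1) → ‖((gaugeAct g W x ν : 𝕄ˣ) : 𝕄) - 1‖ ≤ a) ∧
      (∀ x : Site d, (∀ i, |x i - y₀ i| ≤ (R : ℤ)) →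
        ‖∑ ν : Fin d, ((((gaugeAct g W x ν : 𝕄ˣ) : 𝕄) - 1) - (((gaugeAct g W (x - e ν) ν : 𝕄ˣ) : 𝕄) - 1))‖ ≤ δ))
    (hline : 2 * (d : ℝ) * CU / R + (4 * R * δ + 24 * R * d * a ^ 2 + 2 * a) * CU + 8 * R * d * a ≤ 1 / 2) :
    (∀ (x : Site d) (μ : Fin d), ‖gaugeDir W u x μ‖ ≤ 4 * R * B) ∧ (∀ y : Site d, ‖u y‖ ≤ 4 * CU * R * B) := by
  classical
  have hR0 : (0 : ℝ) < R := by exact_mod_cast hR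
  have hd0 : (0 : ℝ) < d := by exact_mod_cast hd
  have hδ0 : 0 ≤ δ := by
    obtain ⟨g, -, -, hdiv⟩ := hgauge 0 ⟨0, hd⟩
    exact (norm_nonneg _).trans (hdiv 0 fun i => by simp)
  -- the maximal covariant forward difference over one period
  set S : Finset (Site d × Fin d) := (periodBox (d := d) P) ×ˢ (Finset.univ : Finset (Fin d)) with hS_def
  have hmemS : ∀ (x : Site d) (i : Fin d), (cmod P x, i) ∈ S := fun x i => by
    rw [hS_def, Finset.mem_product]
    exact ⟨(mem_periodBox).2 fun κ => ⟨cmod_nonneg hP x κ, cmod_lt hP x κ⟩, Finset.mem_univ _⟩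
  have hSne : S.Nonempty := ⟨_, hmemS 0 ⟨0, hd⟩⟩
  obtain ⟨q₀, -, hq₀max⟩ := Finset.exists_max_image S (fun q => ‖gaugeDir W u q.1 q.2‖) hSne
  have hmax : ∀ (x : Site d) (μ : Fin d), ‖gaugeDir W u (cmod P x) μ‖ ≤ ‖gaugeDir W u q₀.1 q₀.2‖ :=
    fun x μ => hq₀max (cmod P x, μ) (hmemS x μ)
  clear hq₀max
  set G : ℝ := ‖gaugeDir W u q₀.1 q₀.2‖ with hG_def
  have hG0 : 0 ≤ G := norm_nonneg _
  have hYP : IsPeriodicDir (gaugeDir W u) (P : ℤ) := isPeriodicDir_gaugeDir hWP huP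
  have hGall : ∀ (x : Site d) (μ : Fin d), ‖gaugeDir W u x μ‖ ≤ G := by
    intro x μ
    have hx : x = cmod P x + (P : ℤ) • cdiv P x := by rw [add_comm, smul_cdiv_add_cmod]
    have h1 : gaugeDir W u x μ = gaugeDir W u (cmod P x) μ := by
      have h := periodic_smul_vec (f := fun z => gaugeDir W u z μ) (fun z κ => hYP z κ μ) (cmod P x) (cdiv P x)
      rw [← hx] at h
      exact h
    rw [h1]
    exact hmax x μ
  -- the sup of `u`
  set U : ℝ := CU * G with hU_def
  have hUall : ∀ y : Site d, ‖u y‖ ≤ U := hU G hGall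
  have hU0 : 0 ≤ U := mul_nonneg hCU hG0
  -- the gauge at the maximising bond
  obtain ⟨g, hgu, hga, hgδ⟩ := hgauge q₀.1 q₀.2
  set W' : Site d → Fin d → 𝕄ˣ := gaugeAct g W with hW'_def
  have hW'u : IsUnitaryCfg W' := isUnitaryCfg_gaugeAct hgu hWu
  set v : Site d → 𝕄 := fun x => Ad (g x) (u x) with hv_def
  have hvU : ∀ x : Site d, ‖v x‖ ≤ U := fun x => by rw [hv_def, norm_Ad_of_unitary (hgu x)]; exact hUall x
  have hvD : ∀ (x : Site d) (μ : Fin d), gaugeDir W' v x μ = Ad (g (x + e μ)) (gaugeDir W u x μ) := fun x μ => by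
    have h := gaugeDir_gaugeAct g W u
    exact congrFun (congrFun h x) μ
  have hvG : ∀ (x : Site d) (μ : Fin d), ‖gaugeDir W' v x μ‖ ≤ G := fun x μ => by
    rw [hvD, norm_Ad_of_unitary (hgu _)]; exact hGall x μ
  have hvB : ∀ y : Site d, ‖covLapSite W' v y‖ ≤ B := fun y => by
    have h := congrFun (covLapSite_gaugeAct g W u) y
    rw [hW'_def, hv_def, h, norm_Ad_of_unitary (hgu y)]
    exact hB y
  -- flat forward differences of `v` near the bond
  set G' : ℝ := G + 2 * a * U with hG'_def
  have hfd : ∀ (x : Site d) (ν : Fin d), (∀ i, |x i - q₀.1 i| ≤ (R : ℤ) + 1) → ‖v (x + e ν) - v x‖ ≤ G' := by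
    intro x ν hx
    have h := (norm_fdiff_le_gaugeDir_add hW'u v x ν).1
    have h2 : 2 * ‖((W' x ν : 𝕄ˣ) : 𝕄) - 1‖ * ‖v x‖ ≤ 2 * a * U :=
      mul_le_mul (mul_le_mul_of_nonneg_left (hga x ν hx) (by norm_num)) (hvU x) (norm_nonneg _) (by positivity)
    linarith [hvG x ν]
  -- the flat Laplacian of `v` on the cube of radius `R`
  set Beff : ℝ := B + 2 * δ * U + 4 * (d : ℝ) * a * G' + 4 * (d : ℝ) * a ^ 2 * U with hBeff_def
  have hcube1 : ∀ x : Site d, (∀ i, |x i - q₀.1 i| ≤ (R : ℤ)) → ∀ i, |x i - q₀.1 i| ≤ (R : ℤ) + 1 := fun x hx i => (hx i).trans (by linarith)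
  have hcube2 : ∀ (x : Site d) (ν : Fin d), (∀ i, |x i - q₀.1 i| ≤ (R : ℤ)) → ∀ i, |(x - e ν) i - q₀.1 i| ≤ (R : ℤ) + 1 := by
    intro x ν hx i
    have h1 := hx i
    rw [Pi.sub_apply, e_apply]
    split_ifs
    · rw [abs_le] at h1 ⊢; constructor <;> linarith [h1.1, h1.2]
    · rw [sub_zero]; exact h1.trans (by linarith)
  have hlap : ∀ x : Site d, (∀ i, |x i - q₀.1 i| ≤ (R : ℤ)) → ‖∑ ν : Fin d, ((v (x + e ν) - v x) - (v x - v (x - e ν)))‖ ≤ Beff := by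
    intro x hx
    have h := norm_flatLaplacian_le hW'u v x (a := a) (δ := δ) (U := U) (G' := G') ha0
      (fun ν => ⟨hga x ν (hcube1 x hx), hga (x - e ν) ν (hcube2 x ν hx)⟩) (hgδ x hx) (hvU x)
      (fun ν => ⟨hfd x ν (hcube1 x hx), by
        have h1 := hfd (x - e ν) ν (hcube2 x ν hx)
        rw [sub_add_cancel] at h1
        rwa [norm_sub_rev]⟩)
    rw [hBeff_def]
    linarith [hvB x]
  -- R37 at the maximising bond
  have hkey := norm_sub_le_of_laplacian q₀.1 q₀.2 hR v (U := U) (B := Beff) (fun x _ => hvU x) hlap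
  -- close the bootstrap
  have hGle : G ≤ 2 * ((d : ℝ) * U / R + R * Beff) + 2 * a * U := by
    have h := (norm_fdiff_le_gaugeDir_add hW'u v q₀.1 q₀.2).2
    have h2 : 2 * ‖((W' q₀.1 q₀.2 : 𝕄ˣ) : 𝕄) - 1‖ * ‖v q₀.1‖ ≤ 2 * a * U :=
      mul_le_mul (mul_le_mul_of_nonneg_left (hga q₀.1 q₀.2 fun i => by simp; positivity) (by norm_num)) (hvU _) (norm_nonneg _) (by positivity)
    have h3 : G = ‖gaugeDir W' v q₀.1 q₀.2‖ := by rw [hvD, norm_Ad_of_unitary (hgu _)]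
    rw [h3]
    linarith
  have hGB : G ≤ 4 * R * B := by
    -- `G ≤ 2RB + G·[2dCU/R + (4Rδ + 24Rda² + 2a)CU + 8Rda] ≤ 2RB + G/2`
    have hexp : 2 * ((d : ℝ) * U / R + R * Beff) + 2 * a * U
        = 2 * R * B + G * (2 * (d : ℝ) * CU / R + (4 * R * δ + 24 * R * d * a ^ 2 + 2 * a) * CU + 8 * R * d * a) := by
      rw [hBeff_def, hG'_def, hU_def]
      field_simp
      ring
    rw [hexp] at hGle
    have h2 : G * (2 * (d : ℝ) * CU / R + (4 * R * δ + 24 * R * d * a ^ 2 + 2 * a) * CU + 8 * R * d * a) ≤ G * (1 / 2) :=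
      mul_le_mul_of_nonneg_left hline hG0
    have hB0 : 0 ≤ B := (norm_nonneg _).trans (hB 0)
    nlinarith
  refine ⟨fun x μ => (hGall x μ).trans hGB, fun y => (hUall y).trans ?_⟩
  rw [hU_def]
  calc CU * G ≤ CU * (4 * R * B) := mul_le_mul_of_nonneg_left hGB hCU
    _ = 4 * CU * R * B := by ring

end

end Summit.QuantumFields.BalabanUV.T4Continuum.NE3.SupRegularityLocalGauge
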